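import Mathlib
import Summits.NavierStokesRegularity.NavierStokesRegularity.Theorems.EulerZoomLiouvillePowerGaugeEulerLiouvilleHoopInequalityTransverse
import Summits.NavierStokesRegularity.NavierStokesRegularity.Theorems.EulerZoomLiouvillePowerGaugeEulerLiouvilleHoopLateralBox

/-!
# LEL-3b: THE LATERAL HOOP INEQUALITY `HoopCore.lateralHoopInequality` (LEAD 19832 g15; nsreg-p2 ROUND-50 t53-LEL 3/3, text VERBATIM)

Helper for crux `EulerZoomLiouville.PowerGaugeEulerLiouville` (stmt-NavierStokesRegularity-19832), LEAD ns-typeII-p2 g15,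
`--supports stmt-NavierStokesRegularity-19832 --as helper`.  nsreg-p2 g40's ROUND-50 «THE WALL COMES FOR FREE» §1 (LEL), `r50/Sketch50.lean`
6c31f8f6e879902e Prop `NsregP2.R50.LateralHoopInequality` VERBATIM: for every `C¹` divergence-free `V : ℝ³ → ℝ³` and every solid cylinder
`Z = solidCyl s₁ s₂ T₀` (`s₁ < s₂`, `T₀ > 0`) about the `x₂`-axis,
`∫_Z hoopDensity V + 2π∫_{s₁}^{s₂} ⟨V_r²⟩_θ(σ,T₀) dσ ≤ 2∫_Z |DV|_F² + π∫_{s₁}^{s₂} (‖V(σe_z)‖² − V_z(σe_z)²) dσ + endFlux V s₁ T₀ + endFlux V s₂ T₀`: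
the WALL term `⟨V_r²⟩_θ(σ,T₀)` of the axis law is paid by the tube's own energy (a second copy of `∫_Z|DV|_F²`), jointly with the hoop functional.

Assembly (the pattern of ns-sfl-p1 g8's `hoopInequality` over ns-ezl-w2 g5's `hoop_box_le`):
* `lateral_box_le` (file `…HoopLateralBox`, LEL-3a) — chart-free box form: ns-ezl-w2's `hoop_slice_le_frame` (hoop part, carrying `−E_σ(T)`)
  PLUS the LEAD's LEL-2 `lateral_slice_le_frame` (wall part, carrying `+E_σ(T)`: the sinuous wall energy CANCELS), `σ`-integration, `σ`-IBP;
* `threeEntries_le_frobeniusNormSq` / `sliceChart_threeEntries_le_frobenius` — the lateral side's entries `⟪DV R_θe₁, R_θe₀⟫² + ⟪DV R_θe₁, R_θe₁⟫²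
  + ⟪DV R_θe₀, R_θe₀⟫² ≤ |DV|_F²` (θ̂-column once more + the rr-entry), integrated over the box;
* `sliceChart_lateral` — `2π∫σ circleAvg(V_r²) σ T₀ = ∫σ∫_θ a(σ,T₀,θ)²`; `lateral_box_le_chart`; **`lateralHoopInequality`**.

HONEST FRAMING: ONE class-free functional inequality (a tool of the hoop / axis-law line: with `axisLawCentre` p693338 and `sliceMassIdentity`
p690507 it gives nsreg-p2's NET axis pressure-drop law t53-NET and the alt-8′ member); it is not a statement about Euler or Navier–Stokes
solutions; crux E (19832) OPEN; NS regularity NOT proved. [nsreg-p2 ROUND-50 §1; ns-idea-11 HOOP-NOTE §10(a); folklore (azimuthal Fourier modes)]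
-/

noncomputable section

open MeasureTheory Set WithLp Metric Real Function Filter Topology
open scoped InnerProductSpace RealInnerProductSpace Interval

set_option linter.dupNamespace false

namespace Summit.NavierStokesRegularity.NavierStokesRegularity.Theorems.PowerGaugeEulerLiouville.HoopCore

open Literature.Analysis Literature.Analysis.FluidPDE Condenser

/-! ## §2 The slice chart: the three lateral entries, the wall term, and the assembly -/

variable {V : EuclideanSpace ℝ (Fin 3) → EuclideanSpace ℝ (Fin 3)}

/-- **The three lateral entries of the Frobenius norm** (θ̂-column once more + the rr-entry): for every linear `L` and every `θ`,
`⟪L R_θe₁, R_θe₀⟫² + ⟪L R_θe₁, R_θe₁⟫² + ⟪L R_θe₀, R_θe₀⟫² ≤ |L|_F²`. [folklore] -/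
theorem threeEntries_le_frobeniusNormSq (L : EuclideanSpace ℝ (Fin 3) →L[ℝ] EuclideanSpace ℝ (Fin 3)) (θ : ℝ) :
    ⟪L (rotZ θ (EuclideanSpace.single (1 : Fin 3) (1 : ℝ))), rotZ θ (EuclideanSpace.single (0 : Fin 3) (1 : ℝ))⟫ ^ 2 +
        ⟪L (rotZ θ (EuclideanSpace.single (1 : Fin 3) (1 : ℝ))), rotZ θ (EuclideanSpace.single (1 : Fin 3) (1 : ℝ))⟫ ^ 2 +
        ⟪L (rotZ θ (EuclideanSpace.single (0 : Fin 3) (1 : ℝ))), rotZ θ (EuclideanSpace.single (0 : Fin 3) (1 : ℝ))⟫ ^ 2 ≤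
      frobeniusNormSq L := by
  set f₀ := rotZ θ (EuclideanSpace.single (0 : Fin 3) (1 : ℝ)) with hf₀
  set f₁ := rotZ θ (EuclideanSpace.single (1 : Fin 3) (1 : ℝ)) with hf₁
  have hF : frobeniusNormSq L = ‖L f₀‖ ^ 2 + ‖L f₁‖ ^ 2 + ‖L eZ‖ ^ 2 := by
    rw [frobeniusNormSq_eq_sum ((EuclideanSpace.basisFun (Fin 3) ℝ).map (rotZLIE θ)) L, Fin.sum_univ_three]
    simp only [OrthonormalBasis.map_apply, EuclideanSpace.basisFun_apply, rotZLIE_apply]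
    rw [← eZ_eq_rotZ θ]
  have h1 : ‖L f₁‖ ^ 2 = ⟪L f₁, f₀⟫ ^ 2 + ⟪L f₁, f₁⟫ ^ 2 + ⟪L f₁, eZ⟫ ^ 2 := by
    rw [← ((EuclideanSpace.basisFun (Fin 3) ℝ).map (rotZLIE θ)).sum_sq_inner_right (L f₁), Fin.sum_univ_three]
    simp only [OrthonormalBasis.map_apply, EuclideanSpace.basisFun_apply, rotZLIE_apply]
    rw [← eZ_eq_rotZ θ, real_inner_comm (L f₁), real_inner_comm (L f₁), real_inner_comm (L f₁)]
  have h2 : ⟪L f₀, f₀⟫ ^ 2 ≤ ‖L f₀‖ ^ 2 := by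
    have h := abs_real_inner_le_norm (L f₀) f₀
    rw [hf₀, norm_rotZ_single_zero, mul_one] at h
    rw [← sq_abs]
    exact pow_le_pow_left₀ (abs_nonneg _) h 2
  rw [hF, h1]
  nlinarith [sq_nonneg ‖L eZ‖, sq_nonneg ⟪L f₁, eZ⟫]

/-- **THE LATERAL FROBENIUS SIDE IN THE SLICE CHART** (`V ∈ C¹`, `s₁ ≤ s₂`, `0 ≤ T₀`):
`∫_{s₁}^{s₂} ∫₀^{T₀} t ∫₀^{2π} [⟪DV R_θe₁, R_θe₀⟫² + ⟪DV R_θe₁, R_θe₁⟫² + ⟪DV R_θe₀, R_θe₀⟫²] ≤ ∫_{solidCyl} |DV|_F²`. [folklore] -/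
theorem sliceChart_threeEntries_le_frobenius (hV : ContDiff ℝ 1 V) {s₁ s₂ T₀ : ℝ} (hs : s₁ ≤ s₂) (hT₀ : 0 ≤ T₀) :
    ∫ σ in s₁..s₂, ∫ t in (0 : ℝ)..T₀, t * ∫ θ in (0 : ℝ)..2 * π,
        (⟪fderiv ℝ V (axisPt σ t θ) (rotZ θ (EuclideanSpace.single (1 : Fin 3) (1 : ℝ))),
            rotZ θ (EuclideanSpace.single (0 : Fin 3) (1 : ℝ))⟫ ^ 2 +
          ⟪fderiv ℝ V (axisPt σ t θ) (rotZ θ (EuclideanSpace.single (1 : Fin 3) (1 : ℝ))),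
            rotZ θ (EuclideanSpace.single (1 : Fin 3) (1 : ℝ))⟫ ^ 2 +
          ⟪fderiv ℝ V (axisPt σ t θ) (rotZ θ (EuclideanSpace.single (0 : Fin 3) (1 : ℝ))),
            rotZ θ (EuclideanSpace.single (0 : Fin 3) (1 : ℝ))⟫ ^ 2) ≤
      ∫ y in solidCyl s₁ s₂ T₀, frobeniusNormSq (fderiv ℝ V y) := by
  rw [setIntegral_frobeniusNormSq_fderiv_solidCyl_eq hV hs hT₀]
  have hF : Continuous fun p : ℝ × ℝ × ℝ =>
      ⟪fderiv ℝ V (axisPt p.1 p.2.1 p.2.2) (rotZ p.2.2 (EuclideanSpace.single (1 : Fin 3) (1 : ℝ))),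
          rotZ p.2.2 (EuclideanSpace.single (0 : Fin 3) (1 : ℝ))⟫ ^ 2 +
        ⟪fderiv ℝ V (axisPt p.1 p.2.1 p.2.2) (rotZ p.2.2 (EuclideanSpace.single (1 : Fin 3) (1 : ℝ))),
          rotZ p.2.2 (EuclideanSpace.single (1 : Fin 3) (1 : ℝ))⟫ ^ 2 +
        ⟪fderiv ℝ V (axisPt p.1 p.2.1 p.2.2) (rotZ p.2.2 (EuclideanSpace.single (0 : Fin 3) (1 : ℝ))),
          rotZ p.2.2 (EuclideanSpace.single (0 : Fin 3) (1 : ℝ))⟫ ^ 2 :=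
    (((continuous_sliceEntry hV continuous_rotZ_single_one continuous_rotZ_single_zero).pow 2).add
      ((continuous_sliceEntry hV continuous_rotZ_single_one continuous_rotZ_single_one).pow 2)).add
      ((continuous_sliceEntry hV continuous_rotZ_single_zero continuous_rotZ_single_zero).pow 2)
  have hG : Continuous fun p : ℝ × ℝ × ℝ => frobeniusNormSq (fderiv ℝ V (axisPt p.1 p.2.1 p.2.2)) := by
    have hc : Continuous fun y => frobeniusNormSq (fderiv ℝ V y) := by
      unfold frobeniusNormSq
      exact continuous_finsetSum _ fun i _ =>
        (((hV.continuous_fderiv one_ne_zero).clm_apply continuous_const).norm).pow 2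
    exact hc.comp continuous_axisPt
  have hFq := continuous_mul_intervalIntegral_slice hF
  have hGq := continuous_mul_intervalIntegral_slice hG
  refine intervalIntegral.integral_mono_on hs
    ((intervalIntegral.continuous_parametric_intervalIntegral_of_continuous' hFq _ _).intervalIntegrable _ _)
    ((intervalIntegral.continuous_parametric_intervalIntegral_of_continuous' hGq _ _).intervalIntegrable _ _)
    fun σ _ => ?_
  refine intervalIntegral.integral_mono_on hT₀
    ((hFq.comp (continuous_const.prodMk continuous_id)).intervalIntegrable _ _)
    ((hGq.comp (continuous_const.prodMk continuous_id)).intervalIntegrable _ _)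
    fun t ht => ?_
  refine mul_le_mul_of_nonneg_left ?_ ht.1
  refine intervalIntegral.integral_mono_on (by positivity)
    ((continuous_uncurry_slice hF σ |>.comp (continuous_const.prodMk continuous_id)).intervalIntegrable _ _)
    ((continuous_uncurry_slice hG σ |>.comp (continuous_const.prodMk continuous_id)).intervalIntegrable _ _)
    fun θ _ => ?_
  exact threeEntries_le_frobeniusNormSq (fderiv ℝ V (axisPt σ t θ)) θ

/-- **The wall term in the slice chart** (`T₀ > 0`): `2π ∫_{s₁}^{s₂} ⟨V_r²⟩_θ(σ,T₀) dσ = ∫_{s₁}^{s₂} ∫₀^{2π} a(σ,T₀,θ)² dθ dσ`,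
`a = ⟪V(axisPt σ T₀ θ), R_θe₀⟫ = V_r`. [folklore] -/
theorem sliceChart_lateral (V : EuclideanSpace ℝ (Fin 3) → EuclideanSpace ℝ (Fin 3)) (s₁ s₂ : ℝ) {T₀ : ℝ} (hT₀ : 0 < T₀) :
    2 * Real.pi * (∫ σ in s₁..s₂, circleAvg (fun y => radialVelocity V y ^ 2) σ T₀) =
      ∫ σ in s₁..s₂, ∫ θ in (0 : ℝ)..2 * π, ⟪V (axisPt σ T₀ θ), rotZ θ (EuclideanSpace.single (0 : Fin 3) (1 : ℝ))⟫ ^ 2 := by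
  rw [← intervalIntegral.integral_const_mul]
  refine intervalIntegral.integral_congr fun σ _ => ?_
  have hπ : (2 * Real.pi) ≠ 0 := by positivity
  simp only [circleAvg]
  rw [intervalIntegral.integral_congr (fun θ _ => by rw [← inner_rotZ_single_zero_eq_radialVelocity V σ hT₀ θ])]
  field_simp

/-- **The box inequality with the wall term, for a `C¹` divergence-free field** (`lateral_box_le` instantiated with the slice chart). [folklore] -/
theorem lateral_box_le_chart (hV : ContDiff ℝ 1 V) (hdiv : ∀ y, VectorCalculus.divergence V y = 0) {s₁ s₂ T₀ : ℝ}
    (hs : s₁ ≤ s₂) (hT₀ : 0 < T₀) :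
    (∫ σ in s₁..s₂, ∫ t in (0 : ℝ)..T₀, t⁻¹ * ∫ θ in (0 : ℝ)..2 * π,
        (⟪V (axisPt σ t θ), rotZ θ (EuclideanSpace.single (0 : Fin 3) (1 : ℝ))⟫ ^ 2 -
          ⟪V (axisPt σ t θ), rotZ θ (EuclideanSpace.single (1 : Fin 3) (1 : ℝ))⟫ ^ 2)) +
      (∫ σ in s₁..s₂, ∫ θ in (0 : ℝ)..2 * π, ⟪V (axisPt σ T₀ θ), rotZ θ (EuclideanSpace.single (0 : Fin 3) (1 : ℝ))⟫ ^ 2) ≤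
      (∫ σ in s₁..s₂, ∫ t in (0 : ℝ)..T₀, t * ∫ θ in (0 : ℝ)..2 * π,
          (⟪fderiv ℝ V (axisPt σ t θ) (rotZ θ (EuclideanSpace.single (1 : Fin 3) (1 : ℝ))),
              rotZ θ (EuclideanSpace.single (0 : Fin 3) (1 : ℝ))⟫ ^ 2 +
            ⟪fderiv ℝ V (axisPt σ t θ) (rotZ θ (EuclideanSpace.single (1 : Fin 3) (1 : ℝ))),
              rotZ θ (EuclideanSpace.single (1 : Fin 3) (1 : ℝ))⟫ ^ 2 +
            ⟪fderiv ℝ V (axisPt σ t θ) eZ, rotZ θ (EuclideanSpace.single (0 : Fin 3) (1 : ℝ))⟫ ^ 2 +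
            ⟪fderiv ℝ V (axisPt σ t θ) (rotZ θ (EuclideanSpace.single (1 : Fin 3) (1 : ℝ))), eZ⟫ ^ 2))
        + (∫ σ in s₁..s₂, ∫ t in (0 : ℝ)..T₀, t * ∫ θ in (0 : ℝ)..2 * π,
          (⟪fderiv ℝ V (axisPt σ t θ) (rotZ θ (EuclideanSpace.single (1 : Fin 3) (1 : ℝ))),
              rotZ θ (EuclideanSpace.single (0 : Fin 3) (1 : ℝ))⟫ ^ 2 +
            ⟪fderiv ℝ V (axisPt σ t θ) (rotZ θ (EuclideanSpace.single (1 : Fin 3) (1 : ℝ))),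
              rotZ θ (EuclideanSpace.single (1 : Fin 3) (1 : ℝ))⟫ ^ 2 +
            ⟪fderiv ℝ V (axisPt σ t θ) (rotZ θ (EuclideanSpace.single (0 : Fin 3) (1 : ℝ))),
              rotZ θ (EuclideanSpace.single (0 : Fin 3) (1 : ℝ))⟫ ^ 2))
        + (∫ σ in s₁..s₂, π⁻¹ * ((∫ y in (0 : ℝ)..2 * π,
            ⟪V (axisPt σ 0 y), rotZ y (EuclideanSpace.single (0 : Fin 3) (1 : ℝ))⟫ * Real.cos y) ^ 2 +
          (∫ y in (0 : ℝ)..2 * π,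
            ⟪V (axisPt σ 0 y), rotZ y (EuclideanSpace.single (0 : Fin 3) (1 : ℝ))⟫ * Real.sin y) ^ 2))
        + (∫ t in (0 : ℝ)..T₀, ∫ θ in (0 : ℝ)..2 * π,
            (⟪V (axisPt s₁ t θ), rotZ θ (EuclideanSpace.single (0 : Fin 3) (1 : ℝ))⟫ ^ 2 +
              (axialVelocity V (axisPt s₁ t θ)) ^ 2))
        + (∫ t in (0 : ℝ)..T₀, ∫ θ in (0 : ℝ)..2 * π,
            (⟪V (axisPt s₂ t θ), rotZ θ (EuclideanSpace.single (0 : Fin 3) (1 : ℝ))⟫ ^ 2 +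
              (axialVelocity V (axisPt s₂ t θ)) ^ 2)) := by
  have hVd : Differentiable ℝ V := hV.differentiable one_ne_zero
  have hVc : Continuous V := hV.continuous
  obtain ⟨C, hC⟩ := exists_mul_abs_hoopDensity_le_solidCyl hV s₁ s₂ hT₀
  exact lateral_box_le
    (a := fun σ t θ => ⟪V (axisPt σ t θ), rotZ θ (EuclideanSpace.single (0 : Fin 3) (1 : ℝ))⟫)
    (b := fun σ t θ => ⟪V (axisPt σ t θ), rotZ θ (EuclideanSpace.single (1 : Fin 3) (1 : ℝ))⟫)
    (c := fun σ t θ => axialVelocity V (axisPt σ t θ))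
    (ad := fun σ t θ => ⟪fderiv ℝ V (axisPt σ t θ) (rotZ θ (EuclideanSpace.single (0 : Fin 3) (1 : ℝ))),
      rotZ θ (EuclideanSpace.single (0 : Fin 3) (1 : ℝ))⟫)
    (aσ := fun σ t θ => ⟪fderiv ℝ V (axisPt σ t θ) eZ, rotZ θ (EuclideanSpace.single (0 : Fin 3) (1 : ℝ))⟫)
    (cσ := fun σ t θ => ⟪fderiv ℝ V (axisPt σ t θ) eZ, eZ⟫)
    (mr := fun σ t θ => ⟪fderiv ℝ V (axisPt σ t θ) (rotZ θ (EuclideanSpace.single (1 : Fin 3) (1 : ℝ))),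
      rotZ θ (EuclideanSpace.single (0 : Fin 3) (1 : ℝ))⟫)
    (mθ := fun σ t θ => ⟪fderiv ℝ V (axisPt σ t θ) (rotZ θ (EuclideanSpace.single (1 : Fin 3) (1 : ℝ))),
      rotZ θ (EuclideanSpace.single (1 : Fin 3) (1 : ℝ))⟫)
    (mz := fun σ t θ => ⟪fderiv ℝ V (axisPt σ t θ) (rotZ θ (EuclideanSpace.single (1 : Fin 3) (1 : ℝ))), eZ⟫)
    (v₀ := fun σ => V (σ • eZ) 0) (v₁ := fun σ => V (σ • eZ) 1)
    (M := C * |2 * π - 0|) hs hT₀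
    (fun σ t θ => hasDerivAt_sliceA_angle hVd σ t θ) (fun σ t θ => hasDerivAt_sliceB_angle hVd σ t θ)
    (fun σ t θ => hasDerivAt_sliceC_angle hVd σ t θ) (fun σ t θ => hasDerivAt_sliceA_radius hVd σ t θ)
    (fun σ t θ => hasDerivAt_sliceA_height hVd σ t θ) (fun σ t θ => hasDerivAt_sliceC_height hVd σ t θ)
    (continuous_sliceA hVc) (continuous_sliceB hVc) (continuous_sliceC hVc)
    (continuous_sliceEntry hV continuous_rotZ_single_zero continuous_rotZ_single_zero)
    (continuous_sliceEntry hV continuous_const continuous_rotZ_single_zero)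
    (continuous_sliceEntry hV continuous_const continuous_const)
    (continuous_sliceEntry hV continuous_rotZ_single_one continuous_rotZ_single_zero)
    (continuous_sliceEntry hV continuous_rotZ_single_one continuous_rotZ_single_one)
    (continuous_sliceEntry hV continuous_rotZ_single_one continuous_const)
    (fun σ t => by simp only [axisPt_two_pi, rotZ_two_pi_single_zero])
    (fun σ t => by simp only [axisPt_two_pi, rotZ_two_pi_single_one])
    (fun σ t => by simp only [axisPt_two_pi])
    (fun σ t θ => by
      have h := hdiv (axisPt σ t θ)
      rw [divergence_eq_rotFrame V _ θ] at h
      linarith)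
    (fun σ θ => by simp only [axisPt_radius_zero, inner_rotZ_single_zero])
    (fun σ hσ t ht => by
      rw [← Real.norm_eq_abs]
      exact norm_sliceLHS_integrand_le hVc σ ht.1 fun θ => hC σ t θ hσ.1 hσ.2 ht.1 ht.2)

/-- **THE LATERAL HOOP INEQUALITY** (nsreg-p2 ROUND-50 §1 (LEL), `NsregP2.R50.LateralHoopInequality` VERBATIM): for every `C¹`
divergence-free `V` and every solid cylinder `Z = solidCyl s₁ s₂ T₀` about the `x₂`-axis (`s₁ < s₂`, `0 < T₀`),
`∫_Z hoopDensity V + 2π∫_{s₁}^{s₂}⟨V_r²⟩_θ(σ,T₀)dσ ≤ 2∫_Z |DV|_F² + π ∫_{s₁}^{s₂} (‖V(σ e_z)‖² − V_z(σ e_z)²) dσ + endFlux V s₁ T₀ + endFlux V s₂ T₀`.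
The wall term `⟨V_r²⟩_θ(σ,T₀)` of the axis law is paid by the tube's own energy (factor 2) — jointly with the hoop functional, never alone.
A class-free tool; not a statement about Euler/NS solutions; 19832 OPEN. [nsreg-p2 ROUND-50 §1; ns-idea-11 HOOP-NOTE §10(a)] -/
theorem lateralHoopInequality :
    ∀ (V : EuclideanSpace ℝ (Fin 3) → EuclideanSpace ℝ (Fin 3)) (s₁ s₂ T₀ : ℝ), s₁ < s₂ → 0 < T₀ → ContDiff ℝ 1 V →
      (∀ y, VectorCalculus.divergence V y = 0) →
        (∫ y in solidCyl s₁ s₂ T₀, hoopDensity V y)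
            + 2 * Real.pi * (∫ σ in s₁..s₂, circleAvg (fun y => radialVelocity V y ^ 2) σ T₀)
          ≤ 2 * (∫ y in solidCyl s₁ s₂ T₀, frobeniusNormSq (fderiv ℝ V y))
            + Real.pi * (∫ σ in s₁..s₂, (‖V (σ • eZ)‖ ^ 2 - (axialVelocity V (σ • eZ)) ^ 2))
            + endFlux V s₁ T₀ + endFlux V s₂ T₀ := by
  intro V s₁ s₂ T₀ hs hT₀ hV hdiv
  have hVc : Continuous V := hV.continuous
  have hbox := lateral_box_le_chart hV hdiv hs.le hT₀
  have hF4 := sliceChart_fourEntries_le_frobenius hV hs.le hT₀.le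
  have hF3 := sliceChart_threeEntries_le_frobenius hV hs.le hT₀.le
  have hA := integral_sliceChart_atom_eq V s₁ s₂
  have hE₁ := sliceChart_endFlux hVc s₁ hT₀
  have hE₂ := sliceChart_endFlux hVc s₂ hT₀
  have hL := sliceChart_lateral V s₁ s₂ hT₀
  -- reorder the four entries (`aσ² + mz²` versus `mz² + aσ²`)
  have hswap : (∫ σ in s₁..s₂, ∫ t in (0 : ℝ)..T₀, t * ∫ θ in (0 : ℝ)..2 * π,
      (⟪fderiv ℝ V (axisPt σ t θ) (rotZ θ (EuclideanSpace.single (1 : Fin 3) (1 : ℝ))),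
          rotZ θ (EuclideanSpace.single (0 : Fin 3) (1 : ℝ))⟫ ^ 2 +
        ⟪fderiv ℝ V (axisPt σ t θ) (rotZ θ (EuclideanSpace.single (1 : Fin 3) (1 : ℝ))),
          rotZ θ (EuclideanSpace.single (1 : Fin 3) (1 : ℝ))⟫ ^ 2 +
        ⟪fderiv ℝ V (axisPt σ t θ) eZ, rotZ θ (EuclideanSpace.single (0 : Fin 3) (1 : ℝ))⟫ ^ 2 +
        ⟪fderiv ℝ V (axisPt σ t θ) (rotZ θ (EuclideanSpace.single (1 : Fin 3) (1 : ℝ))), eZ⟫ ^ 2)) =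
      ∫ σ in s₁..s₂, ∫ t in (0 : ℝ)..T₀, t * ∫ θ in (0 : ℝ)..2 * π,
        (⟪fderiv ℝ V (axisPt σ t θ) (rotZ θ (EuclideanSpace.single (1 : Fin 3) (1 : ℝ))),
            rotZ θ (EuclideanSpace.single (0 : Fin 3) (1 : ℝ))⟫ ^ 2 +
          ⟪fderiv ℝ V (axisPt σ t θ) (rotZ θ (EuclideanSpace.single (1 : Fin 3) (1 : ℝ))),
            rotZ θ (EuclideanSpace.single (1 : Fin 3) (1 : ℝ))⟫ ^ 2 +
          ⟪fderiv ℝ V (axisPt σ t θ) (rotZ θ (EuclideanSpace.single (1 : Fin 3) (1 : ℝ))), eZ⟫ ^ 2 +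
          ⟪fderiv ℝ V (axisPt σ t θ) eZ, rotZ θ (EuclideanSpace.single (0 : Fin 3) (1 : ℝ))⟫ ^ 2) := by
    refine intervalIntegral.integral_congr fun σ _ => intervalIntegral.integral_congr fun t _ => ?_
    congr 1
    exact intervalIntegral.integral_congr fun θ _ => by ring
  rw [setIntegral_hoopDensity_eq_sliceChart hV hs.le hT₀, hL]
  rw [hswap] at hbox
  linarith

end Summit.NavierStokesRegularity.NavierStokesRegularity.Theorems.PowerGaugeEulerLiouville.HoopCore

end
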